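import Summits.BirchSwinnertonDyer.BirchSwinnertonDyer.Theses.GenusKolyvaginAtTwo
import Summits.BirchSwinnertonDyer.BirchSwinnertonDyer.Theses.ByReductionTypeAtTwo
import Summits.BirchSwinnertonDyer.BirchSwinnertonDyer.Theorems.GenusKolyvaginAtTwoLeafCensusWallU2RankOneResidual
import HarnessLib

/-!
# Route `GenusKolyvaginAtTwo` (rev 60): LINE 9 CENSUS — the shifted (even-Tamagawa) habitat is INSIDE WALL row 1, so the four LINE 9 cruxes
# `TamagawaDivisibilityAtTwo` (27467), `ShiftedGenusSupplyAtTwo` (27468), `KolyvaginExactAtTwoShifted` (27469), `ShiftedExactDescentAtTwo` (27470)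
# are IDLE for the residual `OffHabitatResidualAtTwo` (22139): given the four rows, 22139 ⟺ `OffShiftedHabitatResidualAtTwo` (27471) ⟺ U₂ ∧ R′

Seat `bsd-line-gk2-p5` g44 (WIDTH-5 attach, cell `bsd-f1-sign2`); `--supports stmt-BirchSwinnertonDyer-27471` (helper; closes nothing).
THEOREMS ONLY (no definition, no named fact, no `sorry`); standard axioms.  **BSD is NOT proved by this file; no item is closed; WALL row 1 (items
19095–19098 of route `ByReductionTypeAtTwo`), U₂ (22985), the residuals 22139 / 27471 and the LINE 9 cruxes stay OPEN.**  Census bookkeeping in the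
style of p783309 (`nonCMAtTwo_iff_wallRows_and_offHabitatResidual`), p792049 (rank-zero residuals ⟸ WALL) and p794320 (the (α) glue), for LINE 9.

WHY.  LINE 9 (pen bsd-idea-1 g5) split 22139 along the EVEN-Tamagawa habitat
`H_ev = (r_an = 0 ∧ ρ_{E,2^∞} onto ∧ C(E) even ∧ N odd ∧ Δ < 0 ∧ ord₂ C carried by one q₀ ∣ N ∧ an optimal odd-Manin datum)`:
glue 27472 `OffHabitatResidualAtTwoOfShift : J1 → J2 → J3 → J4 → R″ → 22139` (PROVED), with J1 = 27467 (Jetchev at `2`), J2 = 27468 (shifted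
Kolyvagin supply), J3 = 27469 (shifted exactness), J4 = 27470 (shifted descent), R″ = 27471 `OffShiftedHabitatResidualAtTwo` (BSD₂ off BOTH habitats).
But `H_ev` consists of non-CM curves of ANALYTIC RANK ZERO, and the four WALL rows of `ByReductionTypeAtTwo` — binders of every GK2 `closes`
candidate since (680)/(683)/(687) — give `BSD₂` for EVERY non-CM curve of analytic rank `0` (`Census.bsdp_rankZero_of_wallRows`).  Hence:

* §1 `bsdp_shiftedHabitat_of_wallRows` — `H_ev ⊂ WALL`: the cell LINE 9's chain J1 → J2 → J3 → J4 was built to serve is wall-covered outright.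
* §2 `offHabitatResidualAtTwo_of_wallRows_of_offShiftedHabitatResidualAtTwo` — **22139 ⟸ WALL×4 + 27471 ALONE** (J1–J4 dropped), and
  `offHabitatResidualAtTwoOfShift_of_wallRows` — the glue 27472 with its four crux antecedents IDLE given the rows; with the trivial converse
  `offShiftedHabitatResidualAtTwo_of_offHabitatResidualAtTwo`: ★ `offHabitatResidualAtTwo_iff_offShiftedHabitatResidualAtTwo_of_wallRows`
  (**given WALL row 1, 22139 ⟺ 27471**).
* §3 leaf level: `nonCMAtTwo_iff_wallRows_and_offShiftedHabitatResidualAtTwo` (**`NonCMAtTwo` ⟺ WALL×4 ∧ 27471**), and against the LEAD's (α) glue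
  (p794320): `offShiftedHabitatResidualAtTwo_iff_minimalTwinBSDTwo_and_rankOneResidual_of_wallRows` (**given the rows, 27471 ⟺ U₂ ∧ R′**,
  R′ = «non-CM, `r_an = 1`, `#Sel₂ ≠ 2` → BSD₂» inline as in p794320).
READING for the pen / director (census, not an act): modulo WALL row 1 the items 27467–27470 carry NO content toward 22139 or the leaf; 27471 is
the same Prop as 22139 (and as U₂ ∧ R′).  The ONE live use of 27467 in the tree is its `n = 1` instance as the DIVISIBILITY half of U₂'s Δ<0
exponent relation on the slice 𝒮 (gk2-p2 g28, p790748/p792140) — a transfer into U₂'s cell, not into LINE 9's.  Nothing here proves a WALL row,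
U₂, 27467, or BSD for any curve.

References: [Miller2011LMS] Def. 1.1 (BSD(E,p)); [Jetchev2008] Thm. 1.4 (the print shape of 27467, p odd); director-bsd (683)(b), (687).
-/

set_option autoImplicit false
set_option linter.dupNamespace false -- `Summit.<P>.<Sub>` repeats `BirchSwinnertonDyer` (D-0017)

noncomputable section

open scoped Classical

namespace Summit.BirchSwinnertonDyer.BirchSwinnertonDyer.Theorems.GenusExact.Census

open WeierstrassCurve Literature.NumberTheory.EllipticCurves
  Summit.BirchSwinnertonDyer.BirchSwinnertonDyer.Rank1Residual
  Summit.BirchSwinnertonDyer.BirchSwinnertonDyer.Theses.GenusKolyvaginAtTwo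
open Summit.BirchSwinnertonDyer.BirchSwinnertonDyer.Theses.ByReductionTypeAtTwo
  (GoodOrdinaryRankZeroAtTwo MultiplicativeRankZeroAtTwo SupersingularRankZeroAtTwo AdditiveRankZeroAtTwo)

/-! ## §1 The shifted habitat `H_ev` is inside WALL row 1 -/

/-- **`H_ev ⊂ WALL`**: every curve of LINE 9's even-Tamagawa habitat (non-CM, analytic rank `0`, `2`-adic tower onto, `C(E)` even, `N` odd, `Δ < 0`,
`ord₂ C` carried by one `q₀ ∣ N`, an optimal odd-Manin datum — the binder text of `ShiftedGenusSupplyAtTwo` / `OffShiftedHabitatResidualAtTwo` VERBATIM)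
satisfies `BSD₂` by the four WALL rows of `ByReductionTypeAtTwo` (items 19095–19098, displayed as hypotheses), because it has analytic rank `0`
(`bsdp_rankZero_of_wallRows`); the other six clauses are idle.  This is the cell that LINE 9's chain 27467 → 27468 → 27469 → 27470 outputs `BSD₂` on.
Census only; nothing is proved about the rows; BSD is NOT proved. [cite: Miller2011LMS, Def. 1.1] -/
theorem bsdp_shiftedHabitat_of_wallRows (hOrd : GoodOrdinaryRankZeroAtTwo) (hMult : MultiplicativeRankZeroAtTwo)
    (hSS : SupersingularRankZeroAtTwo) (hAdd : AdditiveRankZeroAtTwo)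
    (W : WeierstrassCurve ℚ) [W.IsElliptic] [W.IsGloballyMinimal] [NeZero (W.conductorNorm ℤ)] (hcm : ¬ W.HasCM)
    (hEv : W.analyticRank = 0 ∧ (∀ n : ℕ, 0 < n → W.HasSurjectiveModNGaloisRep ((2 : ℤ) ^ n)) ∧ ¬ Odd W.tamagawaProduct ∧
      ¬ 2 ∣ W.conductorNorm ℤ ∧ W.Δ < 0 ∧
      (∃ (q₀ : ℕ) (_ : Fact q₀.Prime), (q₀ : ℤ) ∣ W.conductorNorm ℤ ∧
        padicValNat 2 ((W.baseChange ℚ_[q₀]).localTamagawaNumber ℤ_[q₀]) = padicValNat 2 W.tamagawaProduct) ∧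
      ∃ Dt : Literature.NumberTheory.EllipticCurves.ModularForms.ModularParametrizationData W (W.conductorNorm ℤ),
        (∀ z ∈ Dt.L.lattice, ∃ w ∈ Literature.NumberTheory.EllipticCurves.ModularForms.periodLattice Dt.f, z = (Dt.c : ℂ) * w) ∧ Odd Dt.c) :
    BSDp W 2 :=
  bsdp_rankZero_of_wallRows hOrd hMult hSS hAdd W hcm hEv.1

/-! ## §2 Given WALL row 1: 22139 ⟺ 27471 (the four LINE 9 cruxes are idle) -/

/-- **27471 ⟸ 22139** (trivial: `OffShiftedHabitatResidualAtTwo` is `OffHabitatResidualAtTwo` with ONE MORE excluded cell, so it asserts less).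
[cite: Miller2011LMS, Def. 1.1] -/
theorem offShiftedHabitatResidualAtTwo_of_offHabitatResidualAtTwo (hR : OffHabitatResidualAtTwo) :
    OffShiftedHabitatResidualAtTwo :=
  fun W _ _ _ hcm hr hH _ ↦ hR W hcm hr hH

/-- **22139 ⟸ WALL×4 + 27471 ALONE** — the LINE 9 cruxes J1 `TamagawaDivisibilityAtTwo` (27467), J2 `ShiftedGenusSupplyAtTwo` (27468), J3
`KolyvaginExactAtTwoShifted` (27469), J4 `ShiftedExactDescentAtTwo` (27470) are NOT needed: a curve off the habitat has analytic rank `0` (then a WALL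
row gives `BSD₂`, whatever its Tamagawa parity — in particular on `H_ev`) or analytic rank `1` (then it is off BOTH habitats, and 27471 applies).
CONDITIONAL on the displayed OPEN items; census only; BSD is NOT proved. [cite: Miller2011LMS, Def. 1.1] -/
theorem offHabitatResidualAtTwo_of_wallRows_of_offShiftedHabitatResidualAtTwo (hOrd : GoodOrdinaryRankZeroAtTwo)
    (hMult : MultiplicativeRankZeroAtTwo) (hSS : SupersingularRankZeroAtTwo) (hAdd : AdditiveRankZeroAtTwo)
    (hR'' : OffShiftedHabitatResidualAtTwo) : OffHabitatResidualAtTwo := by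
  intro W _ _ _ hcm hr hH
  rcases Nat.le_one_iff_eq_zero_or_eq_one.mp hr with h0 | h1
  · exact bsdp_rankZero_of_wallRows hOrd hMult hSS hAdd W hcm h0
  · exact hR'' W hcm hr hH (fun hEv ↦ absurd (h1.symm.trans hEv.1) one_ne_zero)

/-- ★ **Given WALL row 1, `OffHabitatResidualAtTwo` (22139) ⟺ `OffShiftedHabitatResidualAtTwo` (27471)** — modulo the four rows the LINE 9 split of
22139 is the identity on its residual and its four cruxes 27467–27470 are idle.  Census only; BSD is NOT proved. [cite: Miller2011LMS, Def. 1.1] -/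
theorem offHabitatResidualAtTwo_iff_offShiftedHabitatResidualAtTwo_of_wallRows (hOrd : GoodOrdinaryRankZeroAtTwo)
    (hMult : MultiplicativeRankZeroAtTwo) (hSS : SupersingularRankZeroAtTwo) (hAdd : AdditiveRankZeroAtTwo) :
    OffHabitatResidualAtTwo ↔ OffShiftedHabitatResidualAtTwo :=
  ⟨offShiftedHabitatResidualAtTwo_of_offHabitatResidualAtTwo,
    offHabitatResidualAtTwo_of_wallRows_of_offShiftedHabitatResidualAtTwo hOrd hMult hSS hAdd⟩

/-- **The LINE 9 glue `OffHabitatResidualAtTwoOfShift` (27472) from the WALL rows with its four crux antecedents IDLE**: given the rows, the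
implication `J1 → J2 → J3 → J4 → R″ → 22139` holds ignoring `J1 … J4` (underscore binders).  Compare the planner's proof
`offHabitatResidualAtTwoOfShift_proof` (which consumes all five).  Census only; BSD is NOT proved. [cite: Miller2011LMS, Def. 1.1] -/
theorem offHabitatResidualAtTwoOfShift_of_wallRows (hOrd : GoodOrdinaryRankZeroAtTwo) (hMult : MultiplicativeRankZeroAtTwo)
    (hSS : SupersingularRankZeroAtTwo) (hAdd : AdditiveRankZeroAtTwo) : OffHabitatResidualAtTwoOfShift :=
  fun _ _ _ _ hR'' ↦ offHabitatResidualAtTwo_of_wallRows_of_offShiftedHabitatResidualAtTwo hOrd hMult hSS hAdd hR''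

/-! ## §3 Leaf level, and against the (α) glue -/

/-- **`NonCMAtTwo` ⟺ WALL×4 ∧ `OffShiftedHabitatResidualAtTwo` (27471)** — p783309's «leaf ⟺ WALL×4 ∧ 22139» with 22139 replaced by LINE 9's
narrower-looking residual: they are the same modulo the rows (§2).  Census only; BSD is NOT proved. [cite: Miller2011LMS, Def. 1.1] -/
theorem nonCMAtTwo_iff_wallRows_and_offShiftedHabitatResidualAtTwo :
    NonCMAtTwo ↔ (GoodOrdinaryRankZeroAtTwo ∧ MultiplicativeRankZeroAtTwo ∧ SupersingularRankZeroAtTwo ∧ AdditiveRankZeroAtTwo) ∧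
      OffShiftedHabitatResidualAtTwo :=
  ⟨fun h ↦
      have h' := nonCMAtTwo_iff_wallRows_and_offHabitatResidual.mp h
      ⟨h'.1, offShiftedHabitatResidualAtTwo_of_offHabitatResidualAtTwo h'.2⟩,
    fun h ↦ nonCMAtTwo_of_wallRows_of_offHabitatResidual h.1.1 h.1.2.1 h.1.2.2.1 h.1.2.2.2
      (offHabitatResidualAtTwo_of_wallRows_of_offShiftedHabitatResidualAtTwo h.1.1 h.1.2.1 h.1.2.2.1 h.1.2.2.2 h.2)⟩

/-- **Given WALL row 1: `OffShiftedHabitatResidualAtTwo` (27471) ⟺ U₂ `MinimalTwinBSDTwo` ∧ R′** (R′ = the LEAD's inline rank-one non-minimal residual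
of p794320: non-CM, `r_an = 1`, `#Sel₂(W) ≠ 2` → `BSD₂`) — LINE 9's residual against the (α) re-glue: the same Prop as 22139, hence as U₂ ∧ R′,
modulo the rows.  Census only; BSD / U₂ NOT proved. [cite: Miller2011LMS, Def. 1.1] -/
theorem offShiftedHabitatResidualAtTwo_iff_minimalTwinBSDTwo_and_rankOneResidual_of_wallRows (hOrd : GoodOrdinaryRankZeroAtTwo)
    (hMult : MultiplicativeRankZeroAtTwo) (hSS : SupersingularRankZeroAtTwo) (hAdd : AdditiveRankZeroAtTwo) :
    OffShiftedHabitatResidualAtTwo ↔ MinimalTwinBSDTwo ∧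
      (∀ (W : WeierstrassCurve ℚ) [W.IsElliptic] [W.IsGloballyMinimal],
        ¬ W.HasCM → W.analyticRank = 1 → Nat.card (W.selmerGroup 2) ≠ 2 → BSDp W 2) :=
  (offHabitatResidualAtTwo_iff_offShiftedHabitatResidualAtTwo_of_wallRows hOrd hMult hSS hAdd).symm.trans
    (offHabitatResidualAtTwo_iff_minimalTwinBSDTwo_and_rankOneResidual_of_wallRows hOrd hMult hSS hAdd)

end Summit.BirchSwinnertonDyer.BirchSwinnertonDyer.Theorems.GenusExact.Census

end
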